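import Literature.NumberTheory.EllipticCurves.ZpExtensionRelativeDescentProofs
import HarnessLib

/-!
# The kernel of restriction along a procyclic step `N ⊴ H` inside `Γ_K` is finite — for a step
# `H/N ≅ p^k ℤ_p` generated by ANY element (finite coefficients)

PROOFS-ONLY sibling of `ZpExtensionRelativeDescentProofs` (no definition, no named fact, no `sorry`, no
instance). Cell `bsd-2adic` (`run/shared/lean/pub/bsd-2adic/`), seat `bsd-2adic-tower-1` GEN 47; input of the
CONTROL theorem from the `ℤ_p²`-tower down to one `ℤ_p`-line (O2 stmt-BirchSwinnertonDyer-24728, line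
`two_variable_gv_squeeze_two`, stub R0T, key «CTRL₂»), where it is applied to the LOCAL step
`J = Gal(K̄/K_∞^{(2)}) ⊓ I_v̄ ⊵ J' = Gal(K̄/K̃_∞) ⊓ I_v̄` above `v̄`: there `κ₁(J) = p^k ℤ_p` need not contain
`1`, so the hypothesis "`γ ∈ H` with `κ γ = 1`" of GEN 46's `ZpDescent.finite_setOf_resOfLe_eq_zero` is replaced
by "`q ∈ H` whose value `κ q` divides every `κ h`, `h ∈ H`" (a generator of the closed subgroup
`κ(H) ⊆ ℤ_p`), which always exists (`exists_mem_forall_exists_toAdd_eq_mul`, least valuation).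

* §1 `subgroup_eq_top_of_isClosed_of_generator`: a CLOSED subgroup of `H` containing `N ⊇ H ⊓ ker κ` and
  such a `q` is all of `H` (`κ(O)` is closed and contains `ℕ·κ(q)`, dense in `ℤ_p·κ(q) ⊇ κ(H)` by
  `PadicInt.denseRange_natCast`).
* §2 `exists_mem_forall_exists_toAdd_eq_mul`: every subgroup `H ≤ Γ_K` has such a `q` (an element of least
  valuation of `κ(H) ∖ {0}`, or `q = 1` if `κ(H) = 0`; `PadicInt.unitCoeff_spec`).
* §3 **`finite_setOf_resOfLe_eq_zero_of_generator`**: for `H ≤ Γ_K` closed, `N ≤ H` normal in `Γ_K` with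
  `H ⊓ ker κ ≤ N`, `q` as above and `M` finite discrete with continuous action, the kernel of
  `res : H¹(H, M) → H¹(N, M)` is finite — verbatim the argument of GEN 46's §4 (a class dying on `N` is
  represented by `δ` with `δ|_N = ∂b|_N`; `δ − ∂b` is determined by its value at `q`, its zero set being a
  closed subgroup containing `N` and `q`), i.e. `ker res = H¹(H/N, M^N) ↪ M` (Serre I.§2.6 (b)) for the
  procyclic quotient `H/N ≅ κ(H) = p^k ℤ_p`. The case `κ(H) ∋ 1` is GEN 46's theorem.

## References
* [SerreGaloisCohomology1997] J.-P. Serre, *Galois Cohomology*, I.§2.6 (b) (inflation–restriction).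
* [GreenbergLNM1716] R. Greenberg, *Iwasawa theory for elliptic curves*, LNM 1716 (1999), §3 Lemma 3.1 (p. 86),
  Lemma 3.3 (p. 88: the local kernels at a finitely decomposed place are `H¹` of a procyclic group).
* [Washington1997] L. Washington, *Introduction to Cyclotomic Fields*, §13.1.
-/

open Literature.NumberTheory.EllipticCurves Literature.NumberTheory.GaloisRepresentations

namespace Literature.NumberTheory.EllipticCurves

namespace ZpDescent

section Generator

open scoped Pointwise

universe u

variable {K : Type u} [Field K] [NumberField K] {p : ℕ} [Fact p.Prime] (κ : ZpExtension K p)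
  {H N : Subgroup (Field.absoluteGaloisGroup K)} {q : Field.absoluteGaloisGroup K}

/-! ### §1. Closed subgroups of `H` containing `H ⊓ ker κ` and a generator `q` -/

/-- **A closed subgroup `O ≤ H` containing `N ⊇ H ⊓ ker κ` and a GENERATOR `q` of `κ(H)` is all of `H`.**
Here "`q` generates" means `κ h ∈ ℤ_p · κ q` for every `h ∈ H` (additive notation). The image `κ(O) ⊆ ℤ_p` is
compact, hence closed, and contains `n · κ(q)` for all `n ∈ ℕ`; since `ℕ` is dense in `ℤ_p`
(`PadicInt.denseRange_natCast`) and `a ↦ a · κ(q)` is continuous, `κ(O) ⊇ ℤ_p · κ(q) ⊇ κ(H)`, so `O ⊇ O·N = H`.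
(The relative, `p^k`-generator form of GEN 46's `subgroup_eq_top_of_isClosed`, which is the case `κ q = 1`.)
[cite: Washington1997, §13.1] -/
theorem subgroup_eq_top_of_isClosed_of_generator (hH : IsClosed (H : Set (Field.absoluteGaloisGroup K)))
    (hN : ∀ g ∈ H, κ g = 1 → g ∈ N) (hqH : q ∈ H)
    (hq : ∀ h ∈ H, ∃ a : ℤ_[p], (κ h).toAdd = a * (κ q).toAdd)
    (O : Subgroup H) (hO : IsClosed (O : Set H)) (hNO : N.subgroupOf H ≤ O)
    (hqO : (⟨q, hqH⟩ : H) ∈ O) : O = ⊤ := by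
  haveI : CompactSpace H := isCompact_iff_compactSpace.mp hH.isCompact
  set x : ℤ_[p] := (κ q).toAdd with hxdef
  let f : H → ℤ_[p] := fun h ↦ (κ (h : Field.absoluteGaloisGroup K)).toAdd
  have hf : Continuous f :=
    continuous_toAdd.comp ((map_continuous κ).comp continuous_subtype_val)
  have hS : IsClosed (f '' (O : Set H)) := (hO.isCompact.image hf).isClosed
  -- `n · x ∈ f(O)` for all `n : ℕ`
  have hZ : (fun a : ℤ_[p] ↦ a * x) '' Set.range (Nat.cast : ℕ → ℤ_[p]) ⊆ f '' (O : Set H) := by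
    rintro _ ⟨_, ⟨n, rfl⟩, rfl⟩
    refine ⟨(⟨q, hqH⟩ : H) ^ n, O.pow_mem hqO n, ?_⟩
    change (κ (((⟨q, hqH⟩ : H) ^ n : H) : Field.absoluteGaloisGroup K)).toAdd = (n : ℤ_[p]) * x
    rw [SubgroupClass.coe_pow, map_pow, toAdd_pow, nsmul_eq_mul]
  -- hence `ℤ_p · x ⊆ f(O)` by density of `ℕ` and continuity of `a ↦ a x`
  have hmul : Continuous fun a : ℤ_[p] ↦ a * x := continuous_id.mul continuous_const
  have hall : ∀ a : ℤ_[p], a * x ∈ f '' (O : Set H) := by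
    intro a
    have h1 : a * x ∈ (fun a : ℤ_[p] ↦ a * x) '' closure (Set.range (Nat.cast : ℕ → ℤ_[p])) := by
      rw [(PadicInt.denseRange_natCast (p := p)).closure_eq]
      exact ⟨a, Set.mem_univ _, rfl⟩
    have h2 := image_closure_subset_closure_image hmul h1
    rw [← hS.closure_eq]
    exact closure_mono hZ h2
  rw [eq_top_iff]
  intro h _
  obtain ⟨a, ha⟩ := hq h h.2
  obtain ⟨o, ho, hfo⟩ : a * x ∈ f '' (O : Set H) := hall a
  have hκ : κ (o : Field.absoluteGaloisGroup K) = κ (h : Field.absoluteGaloisGroup K) :=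
    Multiplicative.toAdd.injective (hfo.trans ha.symm)
  have hmem : ((o⁻¹ * h : H) : Field.absoluteGaloisGroup K) ∈ N := by
    refine hN _ (o⁻¹ * h).2 ?_
    rw [Subgroup.coe_mul, Subgroup.coe_inv, map_mul, map_inv, hκ, inv_mul_cancel]
  have hmem' : o⁻¹ * h ∈ O := hNO (Subgroup.mem_subgroupOf.mpr hmem)
  have := O.mul_mem ho hmem'
  rwa [mul_inv_cancel_left] at this

/-! ### §2. Every subgroup has a generator of its `κ`-image -/

omit [NumberField K] in
/-- **Every subgroup `H ≤ Γ_K` has an element `q` whose value generates `κ(H)` over `ℤ_p`**: if `κ(H) = 0`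
take `q = 1`; otherwise an element of `H` whose value has the least `p`-adic valuation divides every other
value (`ℤ_p` is a discrete valuation ring, `PadicInt.unitCoeff_spec`). So `κ(H) = ℤ_p · κ(q) = p^k ℤ_p` or `0`:
the closed subgroups of `ℤ_p`. [cite: Washington1997, §13.1] -/
theorem exists_mem_forall_exists_toAdd_eq_mul (H : Subgroup (Field.absoluteGaloisGroup K)) :
    ∃ q ∈ H, ∀ h ∈ H, ∃ a : ℤ_[p], (κ h).toAdd = a * (κ q).toAdd := by
  classical
  by_cases hall : ∀ h ∈ H, κ h = 1
  · refine ⟨1, H.one_mem, fun h hh ↦ ⟨0, ?_⟩⟩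
    rw [hall h hh, toAdd_one, zero_mul]
  push Not at hall
  -- the least valuation of a non-zero value
  have hex : ∃ n : ℕ, ∃ h ∈ H, κ h ≠ 1 ∧ ((κ h).toAdd).valuation = n := by
    obtain ⟨h, hh, hne⟩ := hall
    exact ⟨_, h, hh, hne, rfl⟩
  obtain ⟨q, hqH, hqne, hqval⟩ := Nat.find_spec hex
  have hmin : ∀ h ∈ H, κ h ≠ 1 → Nat.find hex ≤ ((κ h).toAdd).valuation :=
    fun h hh hne ↦ Nat.find_min' hex ⟨h, hh, hne, rfl⟩
  refine ⟨q, hqH, fun h hh ↦ ?_⟩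
  by_cases hh1 : κ h = 1
  · exact ⟨0, by rw [hh1, toAdd_one, zero_mul]⟩
  have hy0 : (κ h).toAdd ≠ 0 := fun h0 ↦ hh1 (toAdd_eq_zero.mp h0)
  have hx0 : (κ q).toAdd ≠ 0 := fun h0 ↦ hqne (toAdd_eq_zero.mp h0)
  have hle : ((κ q).toAdd).valuation ≤ ((κ h).toAdd).valuation := by
    rw [hqval]; exact hmin h hh hh1
  have ey := PadicInt.unitCoeff_spec hy0
  have ex := PadicInt.unitCoeff_spec hx0
  refine ⟨(PadicInt.unitCoeff hy0 : ℤ_[p]) * ((PadicInt.unitCoeff hx0)⁻¹ : ℤ_[p]ˣ) *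
    (p : ℤ_[p]) ^ (((κ h).toAdd).valuation - ((κ q).toAdd).valuation), ?_⟩
  generalize PadicInt.unitCoeff hy0 = uy at ey ⊢
  generalize PadicInt.unitCoeff hx0 = ux at ex ⊢
  generalize ((κ h).toAdd).valuation = vy at ey hle ⊢
  generalize ((κ q).toAdd).valuation = vx at ex hle ⊢
  generalize (κ h).toAdd = y at ey ⊢
  generalize (κ q).toAdd = x at ex ⊢
  subst ey ex
  rw [← pow_sub_mul_pow (p : ℤ_[p]) hle]
  have e1 : (uy : ℤ_[p]) * ((ux⁻¹ : ℤ_[p]ˣ) : ℤ_[p]) * (p : ℤ_[p]) ^ (vy - vx) *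
      ((ux : ℤ_[p]) * (p : ℤ_[p]) ^ vx) =
      (uy : ℤ_[p]) * (((ux⁻¹ : ℤ_[p]ˣ) : ℤ_[p]) * (ux : ℤ_[p])) *
        ((p : ℤ_[p]) ^ (vy - vx) * (p : ℤ_[p]) ^ vx) := by ring
  rw [e1, Units.inv_mul, mul_one]

omit [NumberField K] in
/-- The values of `H` all lie in `ℤ_p · κ(q)` ⟹ so do the values of any smaller subgroup (restating the
generator property along `H' ≤ H`; bookkeeping). [cite: Washington1997, §13.1] -/
theorem forall_exists_toAdd_eq_mul_of_le {H' : Subgroup (Field.absoluteGaloisGroup K)} (hle : H' ≤ H)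
    (hq : ∀ h ∈ H, ∃ a : ℤ_[p], (κ h).toAdd = a * (κ q).toAdd) :
    ∀ h ∈ H', ∃ a : ℤ_[p], (κ h).toAdd = a * (κ q).toAdd :=
  fun h hh ↦ hq h (hle hh)

/-! ### §3. The kernel of restriction along a procyclic step is finite (generator form) -/

/-- **`ker (res : H¹(H, M) → H¹(N, M))` is finite** for `H ≤ Γ_K` closed, `N ≤ H` normal in `Γ_K` with
`H ⊓ ker κ ≤ N`, `q ∈ H` a generator of `κ(H)` (`κ h ∈ ℤ_p κ q` for all `h ∈ H`) and `M` finite discrete with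
continuous action: a class dying on `N` has a representative `δ` with `δ|_N = ∂b|_N`, and `δ − ∂b` is a
crossed homomorphism vanishing on `N`, determined by its value at `q` (its zero set is a closed subgroup of
`H` containing `N` and `q`, i.e. `H`, §1); so `y ↦ δ(q) − (q b − b)` injects the kernel into `M`.
(`ker res ↪ H¹(H/N, M^N)`, `H/N ≅ κ(H)/κ(N)` a quotient of the procyclic `p^kℤ_p`; Serre I.§2.6 (b). For
`κ q = 1` this is GEN 46's `finite_setOf_resOfLe_eq_zero`; the generator form serves the local steps
`Gal(K̄/K_∞^{(2)}) ⊓ I_v̄ ⊵ Gal(K̄/K̃_∞) ⊓ I_v̄` of the control theorem, Greenberg's Lemma 3.3 setting.)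
[cite: SerreGaloisCohomology1997, I.§2.6 (b)] [cite: GreenbergLNM1716, §3 Lemmas 3.1 and 3.3 (pp. 86, 88)] -/
theorem finite_setOf_resOfLe_eq_zero_of_generator {M : Type u} [AddCommGroup M]
    [DistribMulAction (Field.absoluteGaloisGroup K) M] [TopologicalSpace M] [DiscreteTopology M]
    [Finite M] [ContinuousSMul (Field.absoluteGaloisGroup K) M]
    (hH : IsClosed (H : Set (Field.absoluteGaloisGroup K))) (hNH : N ≤ H)
    (hN : ∀ g ∈ H, κ g = 1 → g ∈ N) (hqH : q ∈ H)
    (hq : ∀ h ∈ H, ∃ a : ℤ_[p], (κ h).toAdd = a * (κ q).toAdd) :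
    Set.Finite {y : subgroupH1 H M | resOfLe M hNH y = 0} := by
  classical
  set q' : H := ⟨q, hqH⟩ with hq'def
  -- representatives and the restriction on cocycles
  have hrep : ∀ y : subgroupH1 H M, ∃ ψ : contOneCocycles (discreteTopRep H M), oneCocycleClass _ ψ = y :=
    fun y ↦ oneCocycleClass_surjective _ y
  choose rep hrep using hrep
  have hres : ∀ ψ : contOneCocycles (discreteTopRep H M), resOfLe M hNH (oneCocycleClass _ ψ) =
      oneCocycleClass _ (contOneCocycles.pullback (subgroupInclusion hNH)
        (resHomOfEquivariant (subgroupInclusion hNH) (AddMonoidHom.id M) (fun _ _ ↦ rfl)) ψ) :=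
    fun ψ ↦ map_oneCocycleClass _ _ _ ψ
  have hex : ∀ y : subgroupH1 H M, resOfLe M hNH y = 0 →
      ∃ a : M, ∀ n : N, (rep y).1 (subgroupInclusion hNH n) = (n : Field.absoluteGaloisGroup K) • a - a := by
    intro y hy
    rw [← hrep y, hres, oneCocycleClass_eq_zero_iff] at hy
    obtain ⟨a, ha⟩ := hy
    refine ⟨a, fun n ↦ ?_⟩
    have := ha n
    rw [contOneCocycles.pullback_apply] at this
    exact this
  -- the invariant `F y = δ(q) - (q a - a)`
  let F : subgroupH1 H M → M := fun y ↦
    if hy : resOfLe M hNH y = 0 then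
      (rep y).1 q' - (q • Classical.choose (hex y hy) - Classical.choose (hex y hy)) else 0
  refine Set.Finite.of_finite_image (f := F) (Set.toFinite _) ?_
  intro y₁ hy₁ y₂ hy₂ hF
  simp only [Set.mem_setOf_eq] at hy₁ hy₂
  have hF' : (rep y₁).1 q' - (q • Classical.choose (hex y₁ hy₁) - Classical.choose (hex y₁ hy₁)) =
      (rep y₂).1 q' - (q • Classical.choose (hex y₂ hy₂) - Classical.choose (hex y₂ hy₂)) := by
    simpa only [F, dif_pos hy₁, dif_pos hy₂] using hF
  set a₁ := Classical.choose (hex y₁ hy₁) with ha₁def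
  set a₂ := Classical.choose (hex y₂ hy₂) with ha₂def
  have ha₁ := Classical.choose_spec (hex y₁ hy₁)
  have ha₂ := Classical.choose_spec (hex y₂ hy₂)
  rw [← ha₁def] at ha₁
  rw [← ha₂def] at ha₂
  -- `δ = rep y₁ - rep y₂`, `b = a₁ - a₂`
  set b := a₁ - a₂ with hb
  set δ : contOneCocycles (discreteTopRep H M) := rep y₁ - rep y₂ with hδ
  clear_value b δ
  have hδapply : ∀ h : H, δ.1 h = (rep y₁).1 h - (rep y₂).1 h := fun h ↦ by
    rw [hδ, Submodule.coe_sub, ContinuousMap.sub_apply]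
  have hδN : ∀ n : N, δ.1 (subgroupInclusion hNH n) = (n : Field.absoluteGaloisGroup K) • b - b := by
    intro n
    rw [hδapply, ha₁, ha₂, hb, smul_sub]
    abel
  have hδq : δ.1 q' = q • b - b := by
    rw [hδapply, hb, smul_sub]
    rw [sub_eq_sub_iff_sub_eq_sub] at hF'
    rw [hF']
    abel
  -- the zero set of `δ - ∂b` as a closed subgroup of `H` containing `N'` and `q'`
  have hcoc : ∀ g h : H, δ.1 (g * h) = δ.1 g + (g : Field.absoluteGaloisGroup K) • δ.1 h :=
    fun g h ↦ δ.2 g h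
  let Z : Subgroup H :=
    { carrier := {h | δ.1 h = (h : Field.absoluteGaloisGroup K) • b - b}
      mul_mem' := fun {g h} hg hh ↦ by
        simp only [Set.mem_setOf_eq] at hg hh ⊢
        rw [hcoc, hg, hh, Subgroup.coe_mul, mul_smul,
          smul_sub (g : Field.absoluteGaloisGroup K) ((h : Field.absoluteGaloisGroup K) • b) b]
        abel
      one_mem' := by
        simp only [Set.mem_setOf_eq, Subgroup.coe_one, one_smul, sub_self]
        exact contOneCocycles.apply_one δ
      inv_mem' := fun {h} hh ↦ by
        simp only [Set.mem_setOf_eq] at hh ⊢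
        have h1 := hcoc h⁻¹ h
        rw [inv_mul_cancel, contOneCocycles.apply_one, hh] at h1
        rw [Subgroup.coe_inv] at h1 ⊢
        rw [smul_sub (h : Field.absoluteGaloisGroup K)⁻¹ ((h : Field.absoluteGaloisGroup K) • b) b,
          smul_smul, inv_mul_cancel, one_smul] at h1
        have h2 := eq_neg_of_add_eq_zero_left h1.symm
        rw [h2]
        abel }
  have hZclosed : IsClosed (Z : Set H) := by
    have hcontf : Continuous fun h : H ↦ δ.1 h - ((h : Field.absoluteGaloisGroup K) • b - b) :=
      δ.1.continuous.sub ((continuous_subtype_val.smul continuous_const).sub continuous_const)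
    have e : (Z : Set H) =
        (fun h : H ↦ δ.1 h - ((h : Field.absoluteGaloisGroup K) • b - b)) ⁻¹' {0} := by
      ext h
      rw [Set.mem_preimage, Set.mem_singleton_iff, sub_eq_zero]
      rfl
    rw [e]
    exact (isClosed_discrete ({0} : Set M)).preimage hcontf
  have hNZ : N.subgroupOf H ≤ Z := by
    intro h hh
    rw [Subgroup.mem_subgroupOf] at hh
    have := hδN ⟨h, hh⟩
    exact this
  have hqZ : q' ∈ Z := hδq
  have hZtop : Z = ⊤ :=
    subgroup_eq_top_of_isClosed_of_generator κ hH hN hqH hq Z hZclosed hNZ hqZ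
  have hall : ∀ h : H, δ.1 h = (h : Field.absoluteGaloisGroup K) • b - b := fun h ↦ by
    have : h ∈ Z := hZtop ▸ Subgroup.mem_top h
    exact this
  -- conclusion: `[δ] = 0`, so `y₁ = y₂`
  have hzero : oneCocycleClass _ δ = 0 := (oneCocycleClass_eq_zero_iff _ δ).mpr ⟨b, hall⟩
  rw [hδ, oneCocycleClass_sub, hrep, hrep, sub_eq_zero] at hzero
  exact hzero

/-- **Absolute form**: with `q` chosen by §2, the kernel of `res : H¹(H, M) → H¹(H ⊓ ker κ', M)` along ANY
closed `H ≤ Γ_K` and any normal `N` with `H ⊓ ker κ ≤ N ≤ H` is finite (`M` finite discrete, continuous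
action) — no generator hypothesis left. [cite: SerreGaloisCohomology1997, I.§2.6 (b)]
[cite: GreenbergLNM1716, §3 Lemma 3.3 (p. 88)] -/
theorem finite_setOf_resOfLe_eq_zero_of_inf_ker_le {M : Type u} [AddCommGroup M]
    [DistribMulAction (Field.absoluteGaloisGroup K) M] [TopologicalSpace M] [DiscreteTopology M]
    [Finite M] [ContinuousSMul (Field.absoluteGaloisGroup K) M]
    (hH : IsClosed (H : Set (Field.absoluteGaloisGroup K))) (hNH : N ≤ H)
    (hN : ∀ g ∈ H, κ g = 1 → g ∈ N) :
    Set.Finite {y : subgroupH1 H M | resOfLe M hNH y = 0} := by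
  obtain ⟨q, hqH, hq⟩ := exists_mem_forall_exists_toAdd_eq_mul κ H
  exact finite_setOf_resOfLe_eq_zero_of_generator κ hH hNH hN hqH hq

end Generator

end ZpDescent

end Literature.NumberTheory.EllipticCurves
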